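import Summits.NavierStokesRegularity.NavierStokesRegularity.Theorems.SqueezeCycleNoApexTypeIProfileTypeIBoundIdle
import Summits.NavierStokesRegularity.NavierStokesRegularity.Theorems.SqueezeCycleRecurrentLiouvilleRellichScarResidue
import HarnessLib

/-!
# Route SqueezeCycle / RellichScar · item `ApexLocalisation` (stmt-NavierStokesRegularity-11719):
# the conclusion needs no `𝐈 < ∞` / weak-gradient bookkeeping

Helper file (theorems only; no definitions, no named facts), `--supports` the item.

`ApexLocalisation` (a rate-class Type-I singular slab profile yields an APEX-class one) asks, in its
conclusion, for a suitable weak solution with a weak gradient, Albritton–Barker's `𝐈 < ∞`, the apex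
bound `‖u‖ ≤ C'/(‖x‖+√(−t))` and a backward-singular origin.  By
`NoApexKNSS.exists_apexProfile_repr` (KNSS 2009 §4 mild representative + Riesz pressure with the
Seregin–Šverák scale-invariant package + the envelope bound on `𝐈`), the weak gradient and `𝐈 < ∞`
are AUTOMATIC up to an a.e. modification that keeps the origin singular: the crux is equivalent to
the statement whose conclusion is just "some suitable weak solution on the slab with the apex bound is
singular at the origin" (`apexLocalisation_iff_knss`).  A line on the crux may therefore stop
certifying `𝐈 < ∞` for the profile it constructs.

## References

* G. Koch, N. Nadirashvili, G. Seregin, V. Šverák, Acta Math. 203 (2009) = arXiv:0709.3599, (1.6),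
  Lemma 3.1, §4 Prop. 4.1. [KNSS2009]
* D. Albritton, T. Barker, J. Math. Fluid Mech. 21 (2019) = arXiv:1811.00502, §1. [AlbrittonBarker2019]
-/

noncomputable section

-- the sub-problem namespace repeats the summit name (D-0017 layout `Summit.<S>.<P>.Theorems`)
set_option linter.dupNamespace false

namespace Summit.NavierStokesRegularity.NavierStokesRegularity.Theorems.NoApexKNSS

open Set Filter Function MeasureTheory Metric TopologicalSpace
open scoped Topology ENNReal NNReal
open Literature.Analysis.FluidPDE
open Summit.NavierStokesRegularity.NavierStokesRegularity.Theses
open Summit.NavierStokesRegularity.NavierStokesRegularity.Theorems.ScarRigidity.Negative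
  (pos_const_of_apexSingular)

/-- **`ApexLocalisation` needs no bookkeeping in its conclusion.**  The apex-localisation crux
(stmt-NavierStokesRegularity-11719; RellichScar rank 4 = SqueezeCycle rank 3, same text) is
EQUIVALENT to the statement whose conclusion asks only for a suitable weak solution on the slab with
the apex bound and a backward-singular origin — the weak gradient and `𝐈 < ∞` of the produced profile
come for free from `exists_apexProfile_repr` (the constant is positive at a singular apex, and the
Type-I ancient mild representative with its Riesz pressure is in the full class, still singular).
[cite: KNSS2009, (1.6)] [cite: AlbrittonBarker2019, §1] -/
theorem apexLocalisation_iff_knss :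
    RellichScar.ApexLocalisation ↔
      ∀ C : ℝ, (∃ (u : ℝ → (EuclideanSpace ℝ (Fin 3)) → (EuclideanSpace ℝ (Fin 3)))
          (p : ℝ → (EuclideanSpace ℝ (Fin 3)) → ℝ)
          (G : ℝ → (EuclideanSpace ℝ (Fin 3)) → (EuclideanSpace ℝ (Fin 3)) →L[ℝ] (EuclideanSpace ℝ (Fin 3))),
          IsSuitableWeakSolutionOn (slab (EuclideanSpace ℝ (Fin 3)) (Iio (0 : ℝ)) isOpen_Iio) 1 0 u p ∧
          HasWeakSpatialGradientOn (slab (EuclideanSpace ℝ (Fin 3)) (Iio (0 : ℝ)) isOpen_Iio) u G ∧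
          typeIBound (Iio (0 : ℝ) ×ˢ univ) u p G < ⊤ ∧ HasTypeITimeDecay C u ∧
          IsBackwardSingularPoint u 0) →
        ∃ (C' : ℝ) (u : ℝ → (EuclideanSpace ℝ (Fin 3)) → (EuclideanSpace ℝ (Fin 3)))
          (p : ℝ → (EuclideanSpace ℝ (Fin 3)) → ℝ),
          IsSuitableWeakSolutionOn (slab (EuclideanSpace ℝ (Fin 3)) (Iio (0 : ℝ)) isOpen_Iio) 1 0 u p ∧
          HasTypeIDecay C' u ∧ IsBackwardSingularPoint u 0 := by
  constructor
  · intro hA C hex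
    obtain ⟨C', u, p, G, hs, -, -, hd, hsing⟩ := hA C hex
    exact ⟨C', u, p, hs, hd, hsing⟩
  · intro h C hex
    obtain ⟨C', u, p, hs, hd, hsing⟩ := h C hex
    have hC' : 0 < C' := pos_const_of_apexSingular hd hsing
    obtain ⟨V, Q, hae, hsV, hgV, hIV, hdV⟩ := exists_apexProfile_repr hs hd hC'
    exact ⟨C', V, Q, _, hsV, hgV, hIV, hdV,
      hsing.congr_ae (fun r _ => parabolicCylinder_origin_subset_slab r) hae.symm⟩

/-- **The RecurrentLiouville crux without bookkeeping.**  Composing the landed residue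
`recurrentLiouville_iff_rellichScar` (crux stmt-NavierStokesRegularity-1589 ⟺ RellichScar target ∧
apex-localisation crux, p128754) with the two KNSS forms: the crux is equivalent to
"KNSS (1.6) for suitable weak solutions" ∧ "rate-class singular profiles localise to an apex-class
suitable weak solution singular at the origin" — no weak gradient and no `𝐈` on the apex side.
[cite: AlbrittonBarker2019, Thm. 1.1 and §3] [cite: KNSS2009, (1.6)] -/
theorem recurrentLiouville_iff_knss :
    SqueezeCycle.RecurrentLiouville ↔
      ((∀ (u : ℝ → (EuclideanSpace ℝ (Fin 3)) → (EuclideanSpace ℝ (Fin 3)))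
          (p : ℝ → (EuclideanSpace ℝ (Fin 3)) → ℝ) (C : ℝ),
          IsSuitableWeakSolutionOn (slab (EuclideanSpace ℝ (Fin 3)) (Iio (0 : ℝ)) isOpen_Iio) 1 0 u p →
          HasTypeIDecay C u → ¬ IsBackwardSingularPoint u 0) ∧
      (∀ C : ℝ, (∃ (u : ℝ → (EuclideanSpace ℝ (Fin 3)) → (EuclideanSpace ℝ (Fin 3)))
          (p : ℝ → (EuclideanSpace ℝ (Fin 3)) → ℝ)
          (G : ℝ → (EuclideanSpace ℝ (Fin 3)) → (EuclideanSpace ℝ (Fin 3)) →L[ℝ] (EuclideanSpace ℝ (Fin 3))),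
          IsSuitableWeakSolutionOn (slab (EuclideanSpace ℝ (Fin 3)) (Iio (0 : ℝ)) isOpen_Iio) 1 0 u p ∧
          HasWeakSpatialGradientOn (slab (EuclideanSpace ℝ (Fin 3)) (Iio (0 : ℝ)) isOpen_Iio) u G ∧
          typeIBound (Iio (0 : ℝ) ×ˢ univ) u p G < ⊤ ∧ HasTypeITimeDecay C u ∧
          IsBackwardSingularPoint u 0) →
        ∃ (C' : ℝ) (u : ℝ → (EuclideanSpace ℝ (Fin 3)) → (EuclideanSpace ℝ (Fin 3)))
          (p : ℝ → (EuclideanSpace ℝ (Fin 3)) → ℝ),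
          IsSuitableWeakSolutionOn (slab (EuclideanSpace ℝ (Fin 3)) (Iio (0 : ℝ)) isOpen_Iio) 1 0 u p ∧
          HasTypeIDecay C' u ∧ IsBackwardSingularPoint u 0)) :=
  recurrentLiouville_iff_rellichScar.trans
    (and_congr rellichScar_noApexTypeIProfile_iff_knss apexLocalisation_iff_knss)

/-- The two route copies of the apex-localisation item agree by name. [cite: KNSS2009, (1.6)] -/
theorem apexLocalisation_iff_rellichScar :
    SqueezeCycle.ApexLocalisation ↔ RellichScar.ApexLocalisation := Iff.rfl

end Summit.NavierStokesRegularity.NavierStokesRegularity.Theorems.NoApexKNSS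

end
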